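import Summits.QuantumFields.BalabanUV.Beta.D1BFx.RestKernelBlockSlot

/-!
# `BalabanUV.Beta.D1BFx.RestKernelSlotRowsTwo` — road «BF-x» for binder row D1, slot (K): **«SLOT PACK ROWS FROM BLOCK SIZE 2» — THE SANDWICH AND
# BLOCK SLOT PACKs' ROWS AND END SHAPES WITH THE JET LETTERS DISPLAYED ONLY AT THE BLOCK SIZES `n = m + 1 ≥ 2` THE END READS**
# (`RestKernelSandwichSlot.exists_END_rows_RkSand` p324769 ✓ ∕ `RestKernelBlockSlot.exists_END_rows_RkBlk` p325854 ✓ take the per-scale jet letters at EVERY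
# `m : ℕ`, i.e. also at the block size `n = 1`; the OWNER's END `RoadEndBFxRoadS.d1Rep_BFx_road_sbpS` (PART 12b) evaluates the members only at `n = Lc^m`,
# `m ≥ 1`, `2 ≤ Lc`, and reads `hU` at `n ≥ 2`, while the literal's sockets it displays (`hS : ∀ n, 2 ≤ n → LocStencil (S n) (Cs n) (δS n)`, `hS₂ : ∀ n, 2 ≤ n → …`)
# say nothing at `n = 1` — so a PART 13′ that discharges the jet letters from the literal needs the packs' END shapes FROM LETTERS AT `n ≥ 2` ONLY: this file).

HONEST DEPENDENCY (cell records, verbatim): «continuum YM on T⁴ ⇐ BetaPertH ∧ nine spine estimates (0/9 proved); BetaPertH ⇐ (D1) ∧ (D4) ∧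
CAP+tail; G-an2-4 gates asym, D1 and NE2/3/4.»  HONEST FRAMING (cell contract, verbatim): «discharging `BetaPertH` makes Bałaban's UV stability
UNCONDITIONAL — a real constructive-QFT result; it is NOT the continuum limit and NOT the Clay problem.»  THIS MODULE DISCHARGES NOTHING of the
wall: [folklore] bookkeeping — the two packs' `exists_rows_*` applied to the per-scale jets TRUNCATED TO `0` BELOW BLOCK SIZE 2 (where the zero kernel
carries every letter trivially), and the members at `n ≥ 2` do not see the truncation.  Modulo the displayed [B5] hypotheses `h12` ∕ `h126` and the
DISPLAYED n-UNIFORM JET LETTERS at `m ≥ 1` (`σV mV κ mW`) — HYPOTHESES, whose n-uniformity at the road's dressed packs is an OPEN (K) estimate, NOT claimed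
here.  No definition, no `def … : Prop`, no notation, nothing cited, 0 sorry.  0 root-level binders of row D1 discharged (hW ∕ hR-sockets ∕ hSX-socket ∕
D1Tel ∕ D1Rep — 0); (K) NOT closed; NOT D1, NOT `BetaPertH`, NOT continuum, NOT Clay.

ABSOLUTE RULE (cell charter, verbatim): «No internally-minted statement may enter as a cited fact. Every hypothesis is either kernel-proved in
this package or a verbatim quotation of a PUBLISHED theorem with page reference. The manuscript(s) under audit are NOT citable for their own
disputed steps — they are the thing under adjudication; programme-internal (2001/route/tribunal) claims are never citable.»

CONTENT (all [folklore]).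
* §1 `ffV_zero_apply`, `ffW_zero_apply`, `blk_zero_apply₂` (the zero jet's blocks vanish, `rfl`), `mass_zero_integrand` (its weighted mass integrand is `0`);
  **`RkSand_congr`** ∕ **`RkBlk_congr`** (a member at block size `n` depends on the jets AT `n` only).
* §2 **`exists_rows_RkSand_two`** ∕ **`exists_END_rows_RkSand_two`** (`2 ≤ Lc`): the sandwich pack's rows at every `n ≥ 2` and its END shapes (i) `hMR`,
  (ii) READING (b), (iii) READING (a), (iv) the unit row at `n ≥ 2`, from the ff jet letters at `m ≥ 1` only.
* §3 **`exists_rows_RkBlk_two`** ∕ **`exists_END_rows_RkBlk_two`**: the same for the block pack (blockwise letters at `m ≥ 1`).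
NOT HERE (honest): any discharge of the jet letters (gan24-leaf-05 «G0-JET-MASS» ∕ «G0-TABLE-MASS», leaf-03 «COFRAME-MASS», the literal's sockets — PART 13′);
the comb-FP and ghost lanes (letter-free resp. discharged at every `m` by leaf-04's `RestKernelFPSlotRoad` ∕ (J2) `RestKernelGhostRoad`); `hptw`; `TshotOf`.
Unit `b2b-balaban-beta-d1-formalise-leaf-01` (gen 24), D1 formalisation swarm leaf prover 01, road «BF-x»; INTENT «SLOT PACK ROWS FROM BLOCK SIZE 2» (journal).
-/

noncomputable section

open Finset
open scoped BigOperators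
open Literature.MathematicalPhysics.QuantumFieldTheory.Balaban1983to89
open Literature.MathematicalPhysics.QuantumFieldTheory.Balaban1983to89.Beta
open B12Sec2to5 (l1 l1_nonneg)
open DecimatedMomentSummable (AbsMoment₂)
open ExpKernelCalculus (Site MKer)
open OneStepResolventKernel (Fib)
open VectorTailsLoc (fam kfam)
open Summit.QuantumFields.BalabanUV.Beta.D1BFx.PackedKernelSplit (blk ffV ffW)
open Summit.QuantumFields.BalabanUV.Beta.D1BFx.FrozenLegTails (nOf MOf hn1)
open Summit.QuantumFields.BalabanUV.Beta.D1BFx.RestKernelSandwichSlot (RkSand CUsand exists_rows_RkSand)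
open Summit.QuantumFields.BalabanUV.Beta.D1BFx.RestKernelBlockSlot (RkBlk CUblk RkBlk_succ exists_rows_RkBlk)

namespace Summit.QuantumFields.BalabanUV.Beta.D1BFx.RestKernelSlotRowsTwo

/-! ## §1 The zero jet carries every letter; a member at block size `n` sees the jets at `n` only -/

section Zero

/-- [folklore] The ff block of the zero first-jet family vanishes entrywise (`rfl`). -/
theorem ffV_zero_apply (ρ : Fin 4) (y x z : Site 4) (g f : Fin 4) : ffV (0 : Fin 4 → Site 4 → MKer 4 (Fib 3)) ρ y x z g f = 0 := rfl

/-- [folklore] The ff block of the zero second-table family vanishes entrywise (`rfl`). -/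
theorem ffW_zero_apply (μ : Fin 4) (y : Site 4) (ν : Fin 4) (y' x z : Site 4) (g f : Fin 4) :
    ffW (0 : Fin 4 → Site 4 → Fin 4 → Site 4 → MKer 4 (Fib 3)) μ y ν y' x z g f = 0 := rfl

/-- [folklore] Every block of the zero kernel vanishes entrywise (`rfl`). -/
theorem blk_zero_apply₂ (j k : Bool) (x z : Site 4) (g f : Fin 4) : blk (0 : MKer 4 (Fib 3)) j k x z g f = 0 := rfl

/-- [folklore] The weighted mass integrand of an entrywise-zero kernel is `0`. -/
theorem mass_zero_integrand {K : MKer 4 (Fin 4)} (hK : ∀ x z g f, K x z g f = 0) (w : Site 4 × Site 4 → ℝ) :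
    (fun p : Site 4 × Site 4 => ∑ g, ∑ f, |K p.1 p.2 g f| * w p) = fun _ => 0 := by
  funext p
  simp only [hK, abs_zero, zero_mul, Finset.sum_const_zero]

end Zero

section Congr

variable (a : ℝ) {𝒱 𝒱' : ℕ → Fin 4 → Site 4 → MKer 4 (Fib 3)} {𝒲 𝒲' : ℕ → Fin 4 → Site 4 → Fin 4 → Site 4 → MKer 4 (Fib 3)}

/-- [folklore] **A SANDWICH MEMBER AT BLOCK SIZE `n` DEPENDS ON THE JETS AT `n` ONLY.** -/
theorem RkSand_congr {n : ℕ} (hV : 𝒱' n = 𝒱 n) (hW : 𝒲' n = 𝒲 n) (u : Unit ⊕ (Bool × Bool)) :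
    RkSand a 𝒱' 𝒲' u n = RkSand a 𝒱 𝒲 u n := by
  funext μ ν z
  unfold RkSand
  rw [hV, hW]

/-- [folklore] **A BLOCK MEMBER AT BLOCK SIZE `n` DEPENDS ON THE JETS AT `n` ONLY.** -/
theorem RkBlk_congr {n : ℕ} (hV : 𝒱' n = 𝒱 n) (hW : 𝒲' n = 𝒲 n) (u : (Bool × Bool) ⊕ (Bool × Bool × Bool × Bool)) :
    RkBlk a 𝒱' 𝒲' u n = RkBlk a 𝒱 𝒲 u n := by
  cases n with
  | zero => rfl
  | succ m => rw [RkBlk_succ, RkBlk_succ, hV, hW]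

end Congr

/-! ## §2 The sandwich pack from letters at `m ≥ 1` -/

section Sand

variable {a : ℝ} (ha : 0 < a) {𝒱 : ℕ → Fin 4 → Site 4 → MKer 4 (Fib 3)} {𝒲 : ℕ → Fin 4 → Site 4 → Fin 4 → Site 4 → MKer 4 (Fib 3)}
  {σV mV κ mW : ℝ} {μ ν : Fin 4}
include ha

/-- [folklore] **THE ROWS OF THE SANDWICH LANE AT EVERY BLOCK SIZE `n ≥ 2`, FROM THE JET LETTERS AT `m ≥ 1` ONLY** (mod [B5, Prop. 1.2] ∧ [B5, (1.126)–(1.127)]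
BY NAME): ONE n-free `kG, K ≥ 0`, `c > 0` with `AbsMoment₂ (RkSand a 𝒱 𝒲 u n μ ν)` and `|secondMoment (RkSand a 𝒱 𝒲 u n) μ ν| ≤ CUsand kG K c σV mV κ mW u`
for every member and every `n ≥ 2` — `exists_rows_RkSand` at the jets truncated to `0` below block size 2. -/
theorem exists_rows_RkSand_two (h12 : B5.Prop12Printed (fam nOf hn1 MOf a ha)) (h126 : B5.Kernel126_127Printed (kfam nOf MOf))
    (hσV : 0 < σV)
    (hVs : ∀ (m : ℕ), 1 ≤ m → ∀ (ρ : Fin 4) (y : Site 4), Summable fun p : Site 4 × Site 4 => ∑ g, ∑ f, |ffV (𝒱 (m + 1)) ρ y p.1 p.2 g f|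
      * Real.exp (σV / ((m + 1 : ℕ) : ℝ) * (l1 (p.1 - ((m + 1 : ℕ) : ℤ) • y) + l1 (p.2 - ((m + 1 : ℕ) : ℤ) • y))))
    (hVm : ∀ (m : ℕ), 1 ≤ m → ∀ (ρ : Fin 4) (y : Site 4), ∑' p : Site 4 × Site 4, ∑ g, ∑ f, |ffV (𝒱 (m + 1)) ρ y p.1 p.2 g f|
      * Real.exp (σV / ((m + 1 : ℕ) : ℝ) * (l1 (p.1 - ((m + 1 : ℕ) : ℤ) • y) + l1 (p.2 - ((m + 1 : ℕ) : ℤ) • y))) ≤ mV)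
    (hκ : 0 < κ)
    (hWs : ∀ (m : ℕ), 1 ≤ m → ∀ (z : Site 4), Summable fun p : Site 4 × Site 4 => ∑ g, ∑ f, |ffW (𝒲 (m + 1)) μ 0 ν z p.1 p.2 g f|)
    (hWm : ∀ (m : ℕ), 1 ≤ m → ∀ (z : Site 4),
      ∑' p : Site 4 × Site 4, ∑ g, ∑ f, |ffW (𝒲 (m + 1)) μ 0 ν z p.1 p.2 g f| ≤ mW * Real.exp (-κ * l1 z)) :
    ∃ kG K c : ℝ, 0 < c ∧ 0 ≤ kG ∧ 0 ≤ K ∧ ∀ (u : Unit ⊕ (Bool × Bool)) (n : ℕ), 2 ≤ n →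
      AbsMoment₂ (RkSand a 𝒱 𝒲 u n μ ν) ∧ |B12Beta.secondMoment (RkSand a 𝒱 𝒲 u n) μ ν| ≤ CUsand kG K c σV mV κ mW u := by
  -- the displayed letters are nonnegative (read at `m = 1`)
  have hmV : 0 ≤ mV :=
    (tsum_nonneg fun p => Finset.sum_nonneg fun g _ => Finset.sum_nonneg fun f _ => by positivity).trans (hVm 1 le_rfl 0 0)
  have hmW : 0 ≤ mW := by
    have h := hWm 1 le_rfl 0
    have e : l1 (0 : Site 4) = 0 := by simp [l1]
    rw [e, mul_zero, Real.exp_zero, mul_one] at h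
    exact (tsum_nonneg fun p => Finset.sum_nonneg fun g _ => Finset.sum_nonneg fun f _ => by positivity).trans h
  -- the pack's rows at the truncated jets
  have key := exists_rows_RkSand (𝒱 := fun k => if 2 ≤ k then 𝒱 k else 0)
    (𝒲 := fun k => if 2 ≤ k then 𝒲 k else 0) (mV := mV) (mW := mW) (μ := μ) (ν := ν) ha h12 h126 hσV ?_ ?_ hκ ?_ ?_
  · obtain ⟨kG, K, c, hc, hkG, hK, hrows⟩ := key
    refine ⟨kG, K, c, hc, hkG, hK, fun u n hn => ?_⟩
    rw [← RkSand_congr a (𝒱 := 𝒱) (𝒲 := 𝒲) (𝒱' := fun k => if 2 ≤ k then 𝒱 k else 0) (𝒲' := fun k => if 2 ≤ k then 𝒲 k else 0)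
      (show (if 2 ≤ n then 𝒱 n else 0) = 𝒱 n from if_pos hn) (show (if 2 ≤ n then 𝒲 n else 0) = 𝒲 n from if_pos hn) u]
    exact hrows u n ((Nat.le_succ 1).trans hn)
  · intro m ρ y
    by_cases hm : 2 ≤ m + 1
    · simp only [if_pos hm]
      exact hVs m (by omega) ρ y
    · simp only [if_neg hm]
      rw [mass_zero_integrand (fun x z g f => ffV_zero_apply ρ y x z g f)]
      exact summable_zero
  · intro m ρ y
    by_cases hm : 2 ≤ m + 1
    · simp only [if_pos hm]
      exact hVm m (by omega) ρ y
    · simp only [if_neg hm]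
      rw [mass_zero_integrand (fun x z g f => ffV_zero_apply ρ y x z g f), tsum_zero]
      exact hmV
  · intro m z
    by_cases hm : 2 ≤ m + 1
    · simp only [if_pos hm]
      exact hWs m (by omega) z
    · simp only [if_neg hm]
      have e := mass_zero_integrand (fun x z' g f => ffW_zero_apply μ 0 ν z x z' g f) (fun _ => (1 : ℝ))
      simp only [mul_one] at e
      rw [e]
      exact summable_zero
  · intro m z
    by_cases hm : 2 ≤ m + 1
    · simp only [if_pos hm]
      exact hWm m (by omega) z
    · simp only [if_neg hm]
      have e := mass_zero_integrand (fun x z' g f => ffW_zero_apply μ 0 ν z x z' g f) (fun _ => (1 : ℝ))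
      simp only [mul_one] at e
      rw [e, tsum_zero]
      exact mul_nonneg hmW (Real.exp_pos _).le

/-- [folklore] **THE SANDWICH LANE's END SHAPES FROM LETTERS AT `m ≥ 1`** (`RoadEndBFxDictPointwiseS.hdict_of_pointwise` ∕ PART 11 at `υ := Unit ⊕ (Bool × Bool)`,
`Rk := RkSand a 𝒱 𝒲`; `2 ≤ Lc` so that every `Lc^m`, `m ≥ 1`, is a block size `≥ 2`): (i) `hMR`; (ii) READING (b) (`Ru := 0`, `CU′ := CUsand …`);
(iii) READING (a) (`Ru := secondMoment`, `CU′ := 0`; `hU` at `n ≥ 2`); (iv) the unit row at every `n ≥ 2`.  The `hU₁` fragment is `sum_CUsand(_le)` (p324769). -/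
theorem exists_END_rows_RkSand_two {Lc : ℕ} [NeZero Lc] (hL : 2 ≤ Lc) (h12 : B5.Prop12Printed (fam nOf hn1 MOf a ha))
    (h126 : B5.Kernel126_127Printed (kfam nOf MOf)) (hσV : 0 < σV)
    (hVs : ∀ (m : ℕ), 1 ≤ m → ∀ (ρ : Fin 4) (y : Site 4), Summable fun p : Site 4 × Site 4 => ∑ g, ∑ f, |ffV (𝒱 (m + 1)) ρ y p.1 p.2 g f|
      * Real.exp (σV / ((m + 1 : ℕ) : ℝ) * (l1 (p.1 - ((m + 1 : ℕ) : ℤ) • y) + l1 (p.2 - ((m + 1 : ℕ) : ℤ) • y))))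
    (hVm : ∀ (m : ℕ), 1 ≤ m → ∀ (ρ : Fin 4) (y : Site 4), ∑' p : Site 4 × Site 4, ∑ g, ∑ f, |ffV (𝒱 (m + 1)) ρ y p.1 p.2 g f|
      * Real.exp (σV / ((m + 1 : ℕ) : ℝ) * (l1 (p.1 - ((m + 1 : ℕ) : ℤ) • y) + l1 (p.2 - ((m + 1 : ℕ) : ℤ) • y))) ≤ mV)
    (hκ : 0 < κ)
    (hWs : ∀ (m : ℕ), 1 ≤ m → ∀ (z : Site 4), Summable fun p : Site 4 × Site 4 => ∑ g, ∑ f, |ffW (𝒲 (m + 1)) μ 0 ν z p.1 p.2 g f|)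
    (hWm : ∀ (m : ℕ), 1 ≤ m → ∀ (z : Site 4),
      ∑' p : Site 4 × Site 4, ∑ g, ∑ f, |ffW (𝒲 (m + 1)) μ 0 ν z p.1 p.2 g f| ≤ mW * Real.exp (-κ * l1 z)) :
    ∃ kG K c : ℝ, 0 < c ∧ 0 ≤ kG ∧ 0 ≤ K ∧
      -- (i) `hMR`
      (∀ (u : Unit ⊕ (Bool × Bool)) (m : ℕ), 1 ≤ m → AbsMoment₂ (RkSand a 𝒱 𝒲 u (Lc ^ m) μ ν)) ∧
      -- (ii) READING (b): `hRu` with `Ru := 0`, `CU′ := CUsand …`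
      (∀ (u : Unit ⊕ (Bool × Bool)) (m : ℕ), 1 ≤ m →
        |B12Beta.secondMoment (RkSand a 𝒱 𝒲 u (Lc ^ m)) μ ν - (fun (_ : Unit ⊕ (Bool × Bool)) (_ : ℕ) => (0 : ℝ)) u (Lc ^ m)|
          ≤ CUsand kG K c σV mV κ mW u) ∧
      -- (iii) READING (a): `hRu` with `CU′ := 0` and `hU` with `CU := CUsand …`
      (∀ (u : Unit ⊕ (Bool × Bool)) (m : ℕ), 1 ≤ m →
        |B12Beta.secondMoment (RkSand a 𝒱 𝒲 u (Lc ^ m)) μ ν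
          - (fun (u : Unit ⊕ (Bool × Bool)) (n : ℕ) => B12Beta.secondMoment (RkSand a 𝒱 𝒲 u n) μ ν) u (Lc ^ m)| ≤ (fun _ : Unit ⊕ (Bool × Bool) => (0 : ℝ)) u) ∧
      (∀ n : ℕ, 2 ≤ n → ∀ u : Unit ⊕ (Bool × Bool),
        |(fun (u : Unit ⊕ (Bool × Bool)) (n : ℕ) => B12Beta.secondMoment (RkSand a 𝒱 𝒲 u n) μ ν) u n| ≤ CUsand kG K c σV mV κ mW u) ∧
      -- (iv) the n-uniform unit row at every block size `n ≥ 2`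
      (∀ (u : Unit ⊕ (Bool × Bool)) (n : ℕ), 2 ≤ n → |B12Beta.secondMoment (RkSand a 𝒱 𝒲 u n) μ ν| ≤ CUsand kG K c σV mV κ mW u) := by
  obtain ⟨kG, K, c, hc, hkG, hK, hrows⟩ := exists_rows_RkSand_two ha h12 h126 hσV hVs hVm hκ hWs hWm
  have hLm : ∀ m : ℕ, 1 ≤ m → 2 ≤ Lc ^ m := fun m hm => hL.trans (Nat.le_self_pow (Nat.one_le_iff_ne_zero.mp hm) Lc)
  refine ⟨kG, K, c, hc, hkG, hK, fun u m hm => (hrows u (Lc ^ m) (hLm m hm)).1, fun u m hm => ?_, fun u m _ => ?_, fun n hn u => ?_,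
    fun u n hn => (hrows u n hn).2⟩
  · rw [sub_zero]
    exact (hrows u (Lc ^ m) (hLm m hm)).2
  · rw [sub_self, abs_zero]
  · exact (hrows u n hn).2

end Sand

/-! ## §3 The block pack from letters at `m ≥ 1` -/

section Blk

variable {a : ℝ} (ha : 0 < a) {𝒱 : ℕ → Fin 4 → Site 4 → MKer 4 (Fib 3)} {𝒲 : ℕ → Fin 4 → Site 4 → Fin 4 → Site 4 → MKer 4 (Fib 3)}
  {σV κ : ℝ} {mV mW : Bool → Bool → ℝ} {μ ν : Fin 4}
include ha

/-- [folklore] **THE ROWS OF THE BLOCK LANE AT EVERY BLOCK SIZE `n ≥ 2`, FROM THE BLOCK LETTERS AT `m ≥ 1` ONLY** (mod [B5, Prop. 1.2] ∧ [B5, (1.126)–(1.127)]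
BY NAME): ONE n-free `kG, K ≥ 0`, `c > 0` with `AbsMoment₂ (RkBlk a 𝒱 𝒲 u n μ ν)` and `|secondMoment (RkBlk a 𝒱 𝒲 u n) μ ν| ≤ CUblk kG K c σV mV κ mW u`
for every member and every `n ≥ 2` — `exists_rows_RkBlk` at the jets truncated to `0` below block size 2. -/
theorem exists_rows_RkBlk_two (h12 : B5.Prop12Printed (fam nOf hn1 MOf a ha)) (h126 : B5.Kernel126_127Printed (kfam nOf MOf))
    (hσV : 0 < σV)
    (hVs : ∀ (m : ℕ), 1 ≤ m → ∀ (ρ : Fin 4) (y : Site 4) (j k : Bool), Summable fun p : Site 4 × Site 4 => ∑ g, ∑ f, |blk (𝒱 (m + 1) ρ y) j k p.1 p.2 g f|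
      * Real.exp (σV / ((m + 1 : ℕ) : ℝ) * (l1 (p.1 - ((m + 1 : ℕ) : ℤ) • y) + l1 (p.2 - ((m + 1 : ℕ) : ℤ) • y))))
    (hVm : ∀ (m : ℕ), 1 ≤ m → ∀ (ρ : Fin 4) (y : Site 4) (j k : Bool), ∑' p : Site 4 × Site 4, ∑ g, ∑ f, |blk (𝒱 (m + 1) ρ y) j k p.1 p.2 g f|
      * Real.exp (σV / ((m + 1 : ℕ) : ℝ) * (l1 (p.1 - ((m + 1 : ℕ) : ℤ) • y) + l1 (p.2 - ((m + 1 : ℕ) : ℤ) • y))) ≤ mV j k)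
    (hκ : 0 < κ)
    (hWs : ∀ (m : ℕ), 1 ≤ m → ∀ (z : Site 4) (j i : Bool),
      Summable fun p : Site 4 × Site 4 => ∑ g, ∑ f, |blk (𝒲 (m + 1) μ 0 ν z) j i p.1 p.2 g f|)
    (hWm : ∀ (m : ℕ), 1 ≤ m → ∀ (z : Site 4) (j i : Bool), ∑' p : Site 4 × Site 4, ∑ g, ∑ f, |blk (𝒲 (m + 1) μ 0 ν z) j i p.1 p.2 g f|
      ≤ mW j i * Real.exp (-κ * l1 z)) :
    ∃ kG K c : ℝ, 0 < c ∧ 0 ≤ kG ∧ 0 ≤ K ∧ ∀ (u : (Bool × Bool) ⊕ (Bool × Bool × Bool × Bool)) (n : ℕ), 2 ≤ n →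
      AbsMoment₂ (RkBlk a 𝒱 𝒲 u n μ ν) ∧ |B12Beta.secondMoment (RkBlk a 𝒱 𝒲 u n) μ ν| ≤ CUblk kG K c σV mV κ mW u := by
  -- the displayed letters are nonnegative (read at `m = 1`)
  have hmV : ∀ j k, 0 ≤ mV j k := fun j k =>
    (tsum_nonneg fun p => Finset.sum_nonneg fun g _ => Finset.sum_nonneg fun f _ => by positivity).trans (hVm 1 le_rfl 0 0 j k)
  have hmW : ∀ j i, 0 ≤ mW j i := fun j i => by
    have h := hWm 1 le_rfl 0 j i
    have e : l1 (0 : Site 4) = 0 := by simp [l1]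
    rw [e, mul_zero, Real.exp_zero, mul_one] at h
    exact (tsum_nonneg fun p => Finset.sum_nonneg fun g _ => Finset.sum_nonneg fun f _ => by positivity).trans h
  -- the pack's rows at the truncated jets
  have key := exists_rows_RkBlk (𝒱 := fun k => if 2 ≤ k then 𝒱 k else 0)
    (𝒲 := fun k => if 2 ≤ k then 𝒲 k else 0) (mV := mV) (mW := mW) (μ := μ) (ν := ν) ha h12 h126 hσV ?_ ?_ hκ ?_ ?_
  · obtain ⟨kG, K, c, hc, hkG, hK, hrows⟩ := key
    refine ⟨kG, K, c, hc, hkG, hK, fun u n hn => ?_⟩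
    rw [← RkBlk_congr a (𝒱 := 𝒱) (𝒲 := 𝒲) (𝒱' := fun k => if 2 ≤ k then 𝒱 k else 0) (𝒲' := fun k => if 2 ≤ k then 𝒲 k else 0)
      (show (if 2 ≤ n then 𝒱 n else 0) = 𝒱 n from if_pos hn) (show (if 2 ≤ n then 𝒲 n else 0) = 𝒲 n from if_pos hn) u]
    exact hrows u n ((Nat.le_succ 1).trans hn)
  · intro m ρ y j k
    by_cases hm : 2 ≤ m + 1
    · simp only [if_pos hm]
      exact hVs m (by omega) ρ y j k
    · simp only [if_neg hm, Pi.zero_apply]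
      rw [mass_zero_integrand (fun x z g f => blk_zero_apply₂ j k x z g f)]
      exact summable_zero
  · intro m ρ y j k
    by_cases hm : 2 ≤ m + 1
    · simp only [if_pos hm]
      exact hVm m (by omega) ρ y j k
    · simp only [if_neg hm, Pi.zero_apply]
      rw [mass_zero_integrand (fun x z g f => blk_zero_apply₂ j k x z g f), tsum_zero]
      exact hmV j k
  · intro m z j i
    by_cases hm : 2 ≤ m + 1
    · simp only [if_pos hm]
      exact hWs m (by omega) z j i
    · simp only [if_neg hm, Pi.zero_apply]
      have e := mass_zero_integrand (fun x z' g f => blk_zero_apply₂ j i x z' g f) (fun _ => (1 : ℝ))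
      simp only [mul_one] at e
      rw [e]
      exact summable_zero
  · intro m z j i
    by_cases hm : 2 ≤ m + 1
    · simp only [if_pos hm]
      exact hWm m (by omega) z j i
    · simp only [if_neg hm, Pi.zero_apply]
      have e := mass_zero_integrand (fun x z' g f => blk_zero_apply₂ j i x z' g f) (fun _ => (1 : ℝ))
      simp only [mul_one] at e
      rw [e, tsum_zero]
      exact mul_nonneg (hmW j i) (Real.exp_pos _).le

/-- [folklore] **THE BLOCK LANE's END SHAPES FROM LETTERS AT `m ≥ 1`** (`RoadEndBFxDictPointwiseS.hdict_of_pointwise` ∕ PART 11 at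
`υ := (Bool × Bool) ⊕ (Bool × Bool × Bool × Bool)`, `Rk := RkBlk a 𝒱 𝒲`; `2 ≤ Lc`): (i) `hMR`; (ii) READING (b) (`Ru := 0`, `CU′ := CUblk …`);
(iii) READING (a) (`Ru := secondMoment`, `CU′ := 0`; `hU` at `n ≥ 2`); (iv) the unit row at every `n ≥ 2`.  The `hU₁` fragment is `sum_CUblk(_le)` (p325854). -/
theorem exists_END_rows_RkBlk_two {Lc : ℕ} [NeZero Lc] (hL : 2 ≤ Lc) (h12 : B5.Prop12Printed (fam nOf hn1 MOf a ha))
    (h126 : B5.Kernel126_127Printed (kfam nOf MOf)) (hσV : 0 < σV)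
    (hVs : ∀ (m : ℕ), 1 ≤ m → ∀ (ρ : Fin 4) (y : Site 4) (j k : Bool), Summable fun p : Site 4 × Site 4 => ∑ g, ∑ f, |blk (𝒱 (m + 1) ρ y) j k p.1 p.2 g f|
      * Real.exp (σV / ((m + 1 : ℕ) : ℝ) * (l1 (p.1 - ((m + 1 : ℕ) : ℤ) • y) + l1 (p.2 - ((m + 1 : ℕ) : ℤ) • y))))
    (hVm : ∀ (m : ℕ), 1 ≤ m → ∀ (ρ : Fin 4) (y : Site 4) (j k : Bool), ∑' p : Site 4 × Site 4, ∑ g, ∑ f, |blk (𝒱 (m + 1) ρ y) j k p.1 p.2 g f|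
      * Real.exp (σV / ((m + 1 : ℕ) : ℝ) * (l1 (p.1 - ((m + 1 : ℕ) : ℤ) • y) + l1 (p.2 - ((m + 1 : ℕ) : ℤ) • y))) ≤ mV j k)
    (hκ : 0 < κ)
    (hWs : ∀ (m : ℕ), 1 ≤ m → ∀ (z : Site 4) (j i : Bool),
      Summable fun p : Site 4 × Site 4 => ∑ g, ∑ f, |blk (𝒲 (m + 1) μ 0 ν z) j i p.1 p.2 g f|)
    (hWm : ∀ (m : ℕ), 1 ≤ m → ∀ (z : Site 4) (j i : Bool), ∑' p : Site 4 × Site 4, ∑ g, ∑ f, |blk (𝒲 (m + 1) μ 0 ν z) j i p.1 p.2 g f|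
      ≤ mW j i * Real.exp (-κ * l1 z)) :
    ∃ kG K c : ℝ, 0 < c ∧ 0 ≤ kG ∧ 0 ≤ K ∧
      -- (i) `hMR`
      (∀ (u : (Bool × Bool) ⊕ (Bool × Bool × Bool × Bool)) (m : ℕ), 1 ≤ m → AbsMoment₂ (RkBlk a 𝒱 𝒲 u (Lc ^ m) μ ν)) ∧
      -- (ii) READING (b): `hRu` with `Ru := 0`, `CU′ := CUblk …`
      (∀ (u : (Bool × Bool) ⊕ (Bool × Bool × Bool × Bool)) (m : ℕ), 1 ≤ m →
        |B12Beta.secondMoment (RkBlk a 𝒱 𝒲 u (Lc ^ m)) μ ν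
          - (fun (_ : (Bool × Bool) ⊕ (Bool × Bool × Bool × Bool)) (_ : ℕ) => (0 : ℝ)) u (Lc ^ m)| ≤ CUblk kG K c σV mV κ mW u) ∧
      -- (iii) READING (a): `hRu` with `CU′ := 0` and `hU` with `CU := CUblk …`
      (∀ (u : (Bool × Bool) ⊕ (Bool × Bool × Bool × Bool)) (m : ℕ), 1 ≤ m →
        |B12Beta.secondMoment (RkBlk a 𝒱 𝒲 u (Lc ^ m)) μ ν
          - (fun (u : (Bool × Bool) ⊕ (Bool × Bool × Bool × Bool)) (n : ℕ) => B12Beta.secondMoment (RkBlk a 𝒱 𝒲 u n) μ ν) u (Lc ^ m)|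
            ≤ (fun _ : (Bool × Bool) ⊕ (Bool × Bool × Bool × Bool) => (0 : ℝ)) u) ∧
      (∀ n : ℕ, 2 ≤ n → ∀ u : (Bool × Bool) ⊕ (Bool × Bool × Bool × Bool),
        |(fun (u : (Bool × Bool) ⊕ (Bool × Bool × Bool × Bool)) (n : ℕ) => B12Beta.secondMoment (RkBlk a 𝒱 𝒲 u n) μ ν) u n|
          ≤ CUblk kG K c σV mV κ mW u) ∧
      -- (iv) the n-uniform unit row at every block size `n ≥ 2`
      (∀ (u : (Bool × Bool) ⊕ (Bool × Bool × Bool × Bool)) (n : ℕ), 2 ≤ n →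
        |B12Beta.secondMoment (RkBlk a 𝒱 𝒲 u n) μ ν| ≤ CUblk kG K c σV mV κ mW u) := by
  obtain ⟨kG, K, c, hc, hkG, hK, hrows⟩ := exists_rows_RkBlk_two ha h12 h126 hσV hVs hVm hκ hWs hWm
  have hLm : ∀ m : ℕ, 1 ≤ m → 2 ≤ Lc ^ m := fun m hm => hL.trans (Nat.le_self_pow (Nat.one_le_iff_ne_zero.mp hm) Lc)
  refine ⟨kG, K, c, hc, hkG, hK, fun u m hm => (hrows u (Lc ^ m) (hLm m hm)).1, fun u m hm => ?_, fun u m _ => ?_, fun n hn u => ?_,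
    fun u n hn => (hrows u n hn).2⟩
  · rw [sub_zero]
    exact (hrows u (Lc ^ m) (hLm m hm)).2
  · rw [sub_self, abs_zero]
  · exact (hrows u n hn).2

end Blk

end Summit.QuantumFields.BalabanUV.Beta.D1BFx.RestKernelSlotRowsTwo

end
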